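import Summits.CriticalPhenomena.PercolationContinuityZ3.Theorems.PercNearOneGluingNoHeavyLowerTailSahiTransportJR3Rows
import Literature.Probability.LatticeModels.StrassenHolleyCoupling

/-!
# `NoHeavyLowerTail` (crux stmt-CriticalPhenomena-4575), Sahi / Kahn positivity: three-sample parameter-free certificates — SOUNDNESS (the certificate)

Support file (cell `prim-l12`, seat P3, gen 5; `--supports stmt-CriticalPhenomena-4575`).  No `sorry`, no named facts, standard axioms.
**`transportCert_of_checkTab3`** — `checkTab3 σ m M ct = true` gives, at every parameter vector, a `SahiTransportCert.TransportCert` for the event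
described by `M` (Strassen); **`sahiE_three_nonneg_of_checkTab3`** — Kahn's Conjecture 5 / Sahi's `C₃` for a block-determined first slot whose
pattern event passes the three-sample check, the other two increasing events arbitrary, every dimension. [this work]
-/

noncomputable section

open scoped Classical

namespace Summit.CriticalPhenomena.PercolationContinuityZ3.Theorems.SahiTransportJR

open Finset SahiHittingSlot SahiTransportCert SahiC3Cube SahiTransportCheck OneCutCert CovTransferCert Literature.Combinatorics.Sahi2008
open Literature.Probability.LatticeModels (exists_monotoneCoupling_of_upperSets_le)
open Literature.Probability.Percolation (DeterminedBy)
open Literature.Probability.Percolation.BHK2006 (weight ind_inter)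
open Literature.Probability.Percolation.DecisionTree (ind ind_of_mem ind_of_not_mem ind_nonneg)

variable {m : ℕ}


/-- **SOUNDNESS OF THE THREE-SAMPLE TABLE CHECK.** [this work] -/
theorem transportCert_of_checkTab3 {σ M : ℕ} {ct : Tab3} (h : checkTab3 σ m M ct = true) {P : Set (Set (Fin m))}
    (hPM : ∀ x, x < 2 ^ m → (M.testBit x = true ↔ pt m x ∈ P)) (q : Fin m → unitInterval) : ∃ Kr, TransportCert q P Kr := by
  unfold checkTab3 at h
  simp only [Bool.and_eq_true, decide_eq_true_eq, List.all_eq_true, Bool.or_eq_true] at h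
  obtain ⟨⟨⟨⟨hσ, hbnd⟩, hstruct⟩, hcap⟩, htc⟩ := h
  have hf := tabFacts3_of_structTab3 hstruct
  set θ := pr q P with hθ
  have hθ0 : 0 ≤ θ := pr_nonneg q P
  have hθ1 : θ ≤ 1 := pr_le_one q P
  have hmem : ∀ S : Set (Fin m), S ∈ P ↔ M.testBit (code S) = true := fun S => by
    rw [hPM _ (code_lt S), pt_code]
  set ν : Set (Fin m) → ℝ := sg3 m M ct q with hν
  have hν0 : ∀ T, 0 ≤ ν T := sg3_nonneg hf q
  have hνH : ∀ T, T ∉ P → ν T = 0 := fun T hT => sg3_eq_zero hf q (by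
    cases hb : M.testBit (code T)
    · rfl
    · exact (hT ((hmem T).2 hb)).elim)
  have hcapT : ∀ T, ν T ≤ (2 - θ) * bernoulliWeight q T := by
    intro T
    by_cases hT : T ∈ P
    · exact capacity3_of_rowOK hPM hf hσ hbnd q T (hcap (code T) (mem_pts.2 ⟨code_lt T, (hmem T).1 hT⟩))
    · rw [hνH T hT]; exact mul_nonneg (by linarith) (bw_nonneg q T)
  have htcT : ∀ 𝒳 𝒵 : Set (Set (Fin m)), IsUpperSet 𝒳 → IsUpperSet 𝒵 → ∑ T, ν T * ind (𝒳 ∩ 𝒵) T ≤ tcR q P 𝒳 𝒵 := by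
    intro 𝒳 𝒵 h𝒳 h𝒵
    have hXu := encA_mem_upsN' h𝒳
    have hZu := encA_mem_upsN' h𝒵
    rcases Nat.lt_or_ge (encA m 𝒵) (encA m 𝒳) with hlt | hle
    · rcases htc (encA m 𝒵) hZu (encA m 𝒳) hXu with hlt' | hok
      · exact absurd hlt' (not_lt.2 hlt.le)
      · rw [Set.inter_comm, tcR_comm]; exact tc3_of_rowOK hPM hf hσ hbnd q 𝒵 𝒳 hok
    · rcases htc (encA m 𝒳) hXu (encA m 𝒵) hZu with hlt' | hok
      · exact absurd hlt' (not_lt.2 hle)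
      · exact tc3_of_rowOK hPM hf hσ hbnd q 𝒳 𝒵 hok
  have hmassν : ∑ T, ν T = pr q Pᶜ * θ := sum_sg3 hPM hf q
  set μ : Set (Fin m) → ℝ := fun S => θ * (bernoulliWeight q S * ind Pᶜ S) with hμ
  have hμ0 : ∀ S, 0 ≤ μ S := fun S => mul_nonneg hθ0 (mul_nonneg (bw_nonneg q S) (ind_nonneg _ _))
  have hmass : ∑ S, μ S = ∑ T, ν T := by
    rw [hmassν]
    simp only [hμ]
    rw [← Finset.mul_sum, mul_comm]
    rfl
  have hdom : ∀ U : Finset (Set (Fin m)), IsUpperSet (U : Set (Set (Fin m))) → ∑ S ∈ U, μ S ≤ ∑ T ∈ U, ν T := by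
    intro U hU
    rw [sum_mem_eq_sum_mul_ind' U μ, sum_mem_eq_sum_mul_ind' U ν]
    have e1 : ∑ S, μ S * ind (↑U : Set (Set (Fin m))) S = θ * pr q (Pᶜ ∩ ↑U) := by
      rw [pr_inter_eq_sum', Finset.mul_sum]
      exact Finset.sum_congr rfl fun S _ => by simp only [hμ]; ring
    rw [e1]
    exact stoch3_of_tabFacts hPM hf q hU
  obtain ⟨π, hπ0, hsupp, hrow, hcol⟩ := exists_monotoneCoupling_of_upperSets_le μ ν hμ0 hν0 hmass hdom
  refine ⟨π, hπ0, fun S T hne => hsupp S T hne, fun S T hne hS => hne ?_, fun S T hne => ?_, fun S hS => ?_, fun T => ?_,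
    fun 𝒳 𝒵 h𝒳 h𝒵 => ?_⟩
  · have hr : ∑ T, π S T = 0 := by rw [hrow S]; simp only [hμ]; rw [ind_of_not_mem (Set.notMem_compl_iff.2 hS)]; ring
    exact (Finset.sum_eq_zero_iff_of_nonneg fun T _ => hπ0 S T).1 hr T (Finset.mem_univ T)
  · by_contra hT
    have hc : ∑ S, π S T = 0 := by rw [hcol T]; exact hνH T hT
    exact hne ((Finset.sum_eq_zero_iff_of_nonneg fun S _ => hπ0 S T).1 hc S (Finset.mem_univ S))
  · rw [hrow S]; simp only [hμ]; rw [ind_of_mem (show S ∈ Pᶜ from hS), mul_one]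
  · rw [hcol T]; exact hcapT T
  · calc ∑ S, ∑ T, π S T * ind (𝒳 ∩ 𝒵) T = ∑ T, (∑ S, π S T) * ind (𝒳 ∩ 𝒵) T := by
          rw [Finset.sum_comm]; simp [Finset.sum_mul]
      _ = ∑ T, ν T * ind (𝒳 ∩ 𝒵) T := Finset.sum_congr rfl fun T _ => by rw [hcol T]
      _ ≤ tcR q P 𝒳 𝒵 := htcT 𝒳 𝒵 h𝒳 h𝒵

/-- **Kahn's Conjecture 5 / Sahi's `C₃` for a junta slot certified by a three-sample table.** [this work] -/
theorem sahiE_three_nonneg_of_checkTab3 {ι : Type} [Fintype ι] {k σ : ℕ} {ct : Tab3} (p : ι → unitInterval) (e : Fin k ↪ ι)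
    {H : Set (Set ι)} (hH : DeterminedBy H (Set.range e)) (h : checkTab3 σ k (encA k (pat e H)) ct = true)
    {U V : Set (Set ι)} (hU : IsUpperSet U) (hV : IsUpperSet V) :
    0 ≤ sahiE (bernoulliWeight p) 3 ![ind H, ind U, ind V] := by
  obtain ⟨Kr, hKr⟩ := transportCert_of_checkTab3 h (encA_spec (pat e H)) (pk e p)
  exact sahiE_three_nonneg_of_transportCert p e hH hKr hU hV

end Summit.CriticalPhenomena.PercolationContinuityZ3.Theorems.SahiTransportJR
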